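import Mathlib
import HarnessLib
import Summits.HubbardSuperconductivity.HubbardSuperconductivity.Theorems.KLProgrammeKLRegimeFlowReadTransportOneCall

/-!
# K3 gen-8-FLOW (stmt-HubbardSuperconductivity-20437 `KLRegimeEngineV17F2`, stub (C) `stub_twoLeg_curvature`): «(C2)-L-SHARP» — the (C2)/(T) one-calls with the
# graded transport parameter priced U-AWARE (`l ≤ 2·4ⁿ`), so that the primed (C2) table is a polynomial of degree ≤ 2 in `R.Gfr` (cell gate-hubbard-kl, seat p2 g23)

LOCATED «(C2)-L-DEGREE» (p2 g23, KL STATUS 2026-08-28): k3c3-p1's `transport_rows_fit` (…FlowReadTransportFit) prices the door's graded parameter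
`l = 4ⁿ·(1 + 2(Gfr₃+Gfr₄)U²)` by `4ⁿ·(1 + 2(Gfr₃+Gfr₄))` (`U ≤ 1`), so its n-free table `eT′ k` is a polynomial of degree `k + 2` in `R.Gfr` while the primed
budget it must fit, `klC4aJetC′ P R k = 2⁸⁰·Psq²·Rsq²`, has degree `4` — for `k ≥ 3` the fit is not uniform in `R`.  CURE (door-side, this file): at stub (C)'s
binders `Gfr_j·U ≤ 2⁻¹²⁷` (`gfr_mul_le_of_le_klEngU₀4`), so `2(Gfr₃+Gfr₄)U² ≤ 1` and `l ≤ 2·4ⁿ`; k3c3-p1's abstract row lemmas `transport_row_*_le` (…TransportRows,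
generic `G34` with `2l ≤ 2x(1+2G34)`) are re-instantiated at `G34 := 1/2`:

* §1 **`transport_rows_fit_l2`** — `transport_rows_fit` with every `(1 + 2(Gfr₃+Gfr₄))` of the table replaced by `2` (hypothesis `2(Gfr₃+Gfr₄)U² ≤ 1`);
* §2 **`transport_jets_flow_fit_of_spaceMoments_l2`**, §3 **`transport_last_flow_fit_of_spaceMoments_l2`** — the «(C2)-ONE-CALL» twins (…FlowReadTransportOneCall)
  on the L2 table (door `transport_jets_flow` / `transport_jets_of_frameOK_fun` + §1 + the same frame/export sizes), below any dominating primed table `eT′`.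

Compositions/arithmetic only (no definitions); nothing here asserts any stub of 20437, K3, the margin or superconductivity.
References: BGM 2006 §2.4 Lemma 2.1 (2.40) [cite: BenfattoGiulianiMastropietro2006]; FST 1996 §1 [cite: FeldmanSalmhoferTrubowitz1996].
-/

noncomputable section

namespace Summit.HubbardSuperconductivity.HubbardSuperconductivity.Theorems.EngineV8

set_option linter.dupNamespace false -- summit = problem name (single-conjunct summit), D-0017
set_option maxSynthPendingDepth 4 -- nested operator-norm instances (fifth Fréchet derivatives), as in the (C2) door

open Real Finset Literature.MathematicalPhysics.QuantumLattice Literature.Probability.LatticeModels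
open Literature.MathematicalPhysics.QuantumLattice.FermiRG
open Summit.HubbardSuperconductivity.HubbardSuperconductivity.Theorems.KLRegimeSplit
open Summit.HubbardSuperconductivity.HubbardSuperconductivity.Theorems.DispersionFlow
open Summit.HubbardSuperconductivity.HubbardSuperconductivity.Theorems.PerturbedFermiCurve

variable {L M : ℕ} [NeZero L] [NeZero M]

/-! ## §1 The rows, L2 pricing -/


/-- **The five canonical rows fit `curveJetBar (fun _ => 0) eT′ U · (n+1)`, L2 PRICING** — k3c3-p1's `transport_rows_fit` with the graded parameter
`l = 4ⁿ(1 + 2(Gfr₃+Gfr₄)U²)` priced by `2·4ⁿ` under `2(Gfr₃+Gfr₄)U² ≤ 1` (every `(1 + 2(Gfr₃+Gfr₄))` of the table becomes `2`: degree ≤ 2 in `R.Gfr` at every order). -/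
theorem transport_rows_fit_l2 {R : RenConsts} (hR : ∀ j, 0 ≤ R.Gfr j) {U : ℝ} (hU : 0 < U) (hU1 : U ≤ 1)
    (hG34U : 2 * (R.Gfr 3 + R.Gfr 4) * U ^ 2 ≤ 1) (n : ℕ)
    {M₁ M₂ M₃ M₄ M₅ : ℝ} (hM1' : 0 ≤ M₁) (hM2' : 0 ≤ M₂) (hM3' : 0 ≤ M₃) (hM4' : 0 ≤ M₄) (hM5' : 0 ≤ M₅)
    {m : ℕ → ℝ} (hm : ∀ j, 0 ≤ m j)
    (hlaw1 : M₁ ≤ m 1 * U ^ 2 * ((4 : ℝ) ^ n) ^ 0) (hlaw2 : M₂ ≤ m 2 * U ^ 2 * ((4 : ℝ) ^ n) ^ 1) (hlaw3 : M₃ ≤ m 3 * U ^ 2 * ((4 : ℝ) ^ n) ^ 2)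
    (hlaw4 : M₄ ≤ m 4 * U ^ 2 * ((4 : ℝ) ^ n) ^ 3) (hlaw5 : M₅ ≤ m 5 * U ^ 2 * ((4 : ℝ) ^ n) ^ 4)
    {D : ℕ → ℝ}
    (hD0 : D 0 ≤ 12.2 * M₁ * (R.Gfr 0 * |U| * ((4 : ℝ) ^ (2 * n))⁻¹))
    (hD1 : D 1 ≤ ((R.Gfr 1 + R.Gfr 2 + R.Gfr 3 + R.Gfr 4) * U ^ 2 * ((4 : ℝ) ^ (2 * n))⁻¹) * (1420 * M₁ * (2 * ((4 : ℝ) ^ n * (1 + 2 * (R.Gfr 3 + R.Gfr 4) * U ^ 2)))) + (R.Gfr 0 * |U| * ((4 : ℝ) ^ (2 * n))⁻¹) * (36400 * M₁ + 2820 * M₂))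
    (hD2 : D 2 ≤ ((R.Gfr 1 + R.Gfr 2 + R.Gfr 3 + R.Gfr 4) * U ^ 2 * ((4 : ℝ) ^ (2 * n))⁻¹) * (12900000 * M₁ * (2 * ((4 : ℝ) ^ n * (1 + 2 * (R.Gfr 3 + R.Gfr 4) * U ^ 2))) ^ 2 + 657000 * M₂ * (2 * ((4 : ℝ) ^ n * (1 + 2 * (R.Gfr 3 + R.Gfr 4) * U ^ 2)))) + (R.Gfr 0 * |U| * ((4 : ℝ) ^ (2 * n))⁻¹) * (338000000 * M₁ * (2 * ((4 : ℝ) ^ n * (1 + 2 * (R.Gfr 3 + R.Gfr 4) * U ^ 2))) + 25400000 * M₂ + 652000 * M₃))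
    (hD3 : D 3 ≤ ((R.Gfr 1 + R.Gfr 2 + R.Gfr 3 + R.Gfr 4) * U ^ 2 * ((4 : ℝ) ^ (2 * n))⁻¹) * (199000000000 * M₁ * (2 * ((4 : ℝ) ^ n * (1 + 2 * (R.Gfr 3 + R.Gfr 4) * U ^ 2))) ^ 3 + 12000000000 * M₂ * (2 * ((4 : ℝ) ^ n * (1 + 2 * (R.Gfr 3 + R.Gfr 4) * U ^ 2))) ^ 2 + 228000000 * M₃ * (2 * ((4 : ℝ) ^ n * (1 + 2 * (R.Gfr 3 + R.Gfr 4) * U ^ 2)))) + (R.Gfr 0 * |U| * ((4 : ℝ) ^ (2 * n))⁻¹) * (5230000000000 * M₁ * (2 * ((4 : ℝ) ^ n * (1 + 2 * (R.Gfr 3 + R.Gfr 4) * U ^ 2))) ^ 2 + 392000000000 * M₂ * (2 * ((4 : ℝ) ^ n * (1 + 2 * (R.Gfr 3 + R.Gfr 4) * U ^ 2))) + 11800000000 * M₃ + 151000000 * M₄))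
    (hD4 : D 4 ≤ ((R.Gfr 1 + R.Gfr 2 + R.Gfr 3 + R.Gfr 4) * U ^ 2 * ((4 : ℝ) ^ (2 * n))⁻¹) * (4300000000000000 * M₁ * (2 * ((4 : ℝ) ^ n * (1 + 2 * (R.Gfr 3 + R.Gfr 4) * U ^ 2))) ^ 4 + 276000000000000 * M₂ * (2 * ((4 : ℝ) ^ n * (1 + 2 * (R.Gfr 3 + R.Gfr 4) * U ^ 2))) ^ 3 + 6890000000000 * M₃ * (2 * ((4 : ℝ) ^ n * (1 + 2 * (R.Gfr 3 + R.Gfr 4) * U ^ 2))) ^ 2 + 70100000000 * M₄ * (2 * ((4 : ℝ) ^ n * (1 + 2 * (R.Gfr 3 + R.Gfr 4) * U ^ 2)))) + (R.Gfr 0 * |U| * ((4 : ℝ) ^ (2 * n))⁻¹) * (114000000000000000 * M₁ * (2 * ((4 : ℝ) ^ n * (1 + 2 * (R.Gfr 3 + R.Gfr 4) * U ^ 2))) ^ 2 + 8490000000000000 * M₂ * (2 * ((4 : ℝ) ^ n * (1 + 2 * (R.Gfr 3 + R.Gfr 4) * U ^ 2))) ^ 2 + 272000000000000 * M₃ * (2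 * ((4 : ℝ) ^ n * (1 + 2 * (R.Gfr 3 + R.Gfr 4) * U ^ 2))) + 4530000000000 * M₄ + 34800000000 * M₅) + 69200000000 * M₁ * (R.Gfr 4 * U ^ 2 * ((16 : ℝ) ^ (n + 1) / 15))) :
    ∀ k ≤ 4, D k ≤
      curveJetBar (fun _ => 0)
        (fun k : ℕ =>
          if k = 0 then 16 * ((12.2 * R.Gfr 0 * m 1))
          else if k = 1 then 4 * ((1420 * 2 * (R.Gfr 1 + R.Gfr 2 + R.Gfr 3 + R.Gfr 4) * 2 * m 1) + (36400 * R.Gfr 0 * m 1) + (2820 * R.Gfr 0 * m 2))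
          else if k = 2 then ((12900000 * 2 ^ 2 * (R.Gfr 1 + R.Gfr 2 + R.Gfr 3 + R.Gfr 4) * 2 ^ 2 * m 1) + (657000 * 2 * (R.Gfr 1 + R.Gfr 2 + R.Gfr 3 + R.Gfr 4) * 2 * m 2) + (338000000 * 2 * R.Gfr 0 * 2 * m 1) + (25400000 * R.Gfr 0 * m 2) + (652000 * R.Gfr 0 * m 3))
          else if k = 3 then ((199000000000 * 2 ^ 3 * (R.Gfr 1 + R.Gfr 2 + R.Gfr 3 + R.Gfr 4) * 2 ^ 3 * m 1) + (12000000000 * 2 ^ 2 * (R.Gfr 1 + R.Gfr 2 + R.Gfr 3 + R.Gfr 4) * 2 ^ 2 * m 2) + (228000000 * 2 * (R.Gfr 1 + R.Gfr 2 + R.Gfr 3 + R.Gfr 4) * 2 * m 3) + (5230000000000 * 2 ^ 2 * R.Gfr 0 * 2 ^ 2 * m 1) + (392000000000 * 2 * R.Gfr 0 * 2 * m 2) + (11800000000 * R.Gfr 0 * m 3) + (151000000 * R.Gfr 0 * m 4)) / 4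
          else if k = 4 then ((4300000000000000 * 2 ^ 4 * (R.Gfr 1 + R.Gfr 2 + R.Gfr 3 + R.Gfr 4) * 2 ^ 4 * m 1) + (276000000000000 * 2 ^ 3 * (R.Gfr 1 + R.Gfr 2 + R.Gfr 3 + R.Gfr 4) * 2 ^ 3 * m 2) + (6890000000000 * 2 ^ 2 * (R.Gfr 1 + R.Gfr 2 + R.Gfr 3 + R.Gfr 4) * 2 ^ 2 * m 3) + (70100000000 * 2 * (R.Gfr 1 + R.Gfr 2 + R.Gfr 3 + R.Gfr 4) * 2 * m 4) + (114000000000000000 * 2 ^ 2 * R.Gfr 0 * 2 ^ 2 * m 1) + (8490000000000000 * 2 ^ 2 * R.Gfr 0 * 2 ^ 2 * m 2) + (272000000000000 * 2 * R.Gfr 0 * 2 * m 3) + (4530000000000 * R.Gfr 0 * m 4) + (34800000000 * R.Gfr 0 * m 5) + (69200000000 * (16 / 15) * R.Gfr 4 * m 1)) / 16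
          else 0)
        U k (n + 1) := by
  have hx : (1 : ℝ) ≤ (4 : ℝ) ^ n := one_le_pow₀ (by norm_num)
  have hx0 : (0 : ℝ) < (4 : ℝ) ^ n := by positivity
  have hU0 : 0 ≤ U := hU.le
  have hUabs : |U| = U := abs_of_pos hU
  have hG0 := hR 0; have hG1 := hR 1; have hG2 := hR 2; have hG3 := hR 3; have hG4 := hR 4
  have hG14 : 0 ≤ R.Gfr 1 + R.Gfr 2 + R.Gfr 3 + R.Gfr 4 := add_nonneg (add_nonneg (add_nonneg hG1 hG2) hG3) hG4
  have hG34 : (0 : ℝ) ≤ 1 / 2 := by norm_num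
  have e16 : ((4 : ℝ) ^ (2 * n))⁻¹ = (((4 : ℝ) ^ n) ^ 2)⁻¹ := by rw [pow_mul']
  have hη : (R.Gfr 1 + R.Gfr 2 + R.Gfr 3 + R.Gfr 4) * U ^ 2 * ((4 : ℝ) ^ (2 * n))⁻¹ ≤
      (R.Gfr 1 + R.Gfr 2 + R.Gfr 3 + R.Gfr 4) * U ^ 2 * (((4 : ℝ) ^ n) ^ 2)⁻¹ := by rw [e16]
  have hη₀ : R.Gfr 0 * |U| * ((4 : ℝ) ^ (2 * n))⁻¹ ≤ R.Gfr 0 * U * (((4 : ℝ) ^ n) ^ 2)⁻¹ := by rw [e16, hUabs]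
  have hη₀' : 0 ≤ R.Gfr 0 * |U| * ((4 : ℝ) ^ (2 * n))⁻¹ := by positivity
  have hl0 : 0 ≤ (4 : ℝ) ^ n * (1 + 2 * (R.Gfr 3 + R.Gfr 4) * U ^ 2) := by positivity
  have hL : 2 * ((4 : ℝ) ^ n * (1 + 2 * (R.Gfr 3 + R.Gfr 4) * U ^ 2)) ≤ 2 * (4 : ℝ) ^ n * (1 + 2 * (1 / 2 : ℝ)) := by
    have h1 : (1 + 2 * (R.Gfr 3 + R.Gfr 4) * U ^ 2) ≤ 1 + 2 * (1 / 2 : ℝ) := by linarith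
    calc 2 * ((4 : ℝ) ^ n * (1 + 2 * (R.Gfr 3 + R.Gfr 4) * U ^ 2)) ≤ 2 * ((4 : ℝ) ^ n * (1 + 2 * (1 / 2 : ℝ))) :=
          mul_le_mul_of_nonneg_left (mul_le_mul_of_nonneg_left h1 hx0.le) zero_le_two
      _ = 2 * (4 : ℝ) ^ n * (1 + 2 * (1 / 2 : ℝ)) := by ring
  have hA : R.Gfr 4 * U ^ 2 * ((16 : ℝ) ^ (n + 1) / 15) ≤ R.Gfr 4 * U ^ 2 * (16 * ((4 : ℝ) ^ n) ^ 2 / 15) := by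
    have e : (16 : ℝ) ^ (n + 1) = 16 * ((4 : ℝ) ^ n) ^ 2 := by
      rw [pow_succ, show (16 : ℝ) = 4 ^ 2 by norm_num, ← pow_mul, ← pow_mul, mul_comm n 2]; ring
    rw [e]
  have hA' : 0 ≤ R.Gfr 4 * U ^ 2 * ((16 : ℝ) ^ (n + 1) / 15) := by positivity
  have h0 := (hD0.trans (transport_row_zero_le hU0 hU1 hx hG0 hm hη₀ hη₀' hlaw1))
  have h1 := (hD1.trans (transport_row_one_le hU0 hU1 hx hG0 hG14 hG34 hm hη hη₀ hl0 hL hlaw1 hlaw2 hM1' hM2'))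
  have h2 := (hD2.trans (transport_row_two_le hU0 hU1 hx hG0 hG14 hG34 hm hη hη₀ hl0 hL hlaw1 hlaw2 hlaw3 hM1' hM2' hM3'))
  have h3 := (hD3.trans (transport_row_three_le hU0 hU1 hx hG0 hG14 hG34 hm hη hη₀ hl0 hL hlaw1 hlaw2 hlaw3 hlaw4 hM1' hM2' hM3' hM4'))
  have h4 := (hD4.trans (transport_row_four_le hU0 hU1 hx hG0 hG14 hG34 hG4 hm hη hη₀ hl0 hL hlaw1 hlaw2 hlaw3 hlaw4 hlaw5 hM1' hM2' hM3'
    hM4' hM5' hA hA'))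
  have e12 : (1 : ℝ) + 2 * (1 / 2) = 2 := by norm_num
  rw [e12] at h1 h2 h3 h4
  intro k hk
  interval_cases k
  · rw [curveJetBar_zero_fst_zero, hUabs]
    refine h0.trans (le_of_eq ?_)
    rw [transport_conv_zero]
    simp only [if_true]
  · rw [curveJetBar_zero_fst_succ _ _ one_ne_zero, hUabs]
    refine h1.trans (le_of_eq ?_)
    rw [transport_conv_one]
    simp only [one_ne_zero, if_false, if_true]
  · rw [curveJetBar_zero_fst_succ _ _ (by norm_num : (2:ℕ) ≠ 0), hUabs]
    refine h2.trans (le_of_eq ?_)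
    rw [transport_conv_two]
    simp only [show (2:ℕ) ≠ 0 from by norm_num, show (2:ℕ) ≠ 1 from by norm_num, if_false, if_true]
  · rw [curveJetBar_zero_fst_succ _ _ (by norm_num : (3:ℕ) ≠ 0), hUabs]
    refine h3.trans (le_of_eq ?_)
    rw [transport_conv_three]
    simp only [show (3:ℕ) ≠ 0 from by norm_num, show (3:ℕ) ≠ 1 from by norm_num, show (3:ℕ) ≠ 2 from by norm_num, if_false, if_true]
  · rw [curveJetBar_zero_fst_succ _ _ (by norm_num : (4:ℕ) ≠ 0), hUabs]
    refine h4.trans (le_of_eq ?_)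
    rw [transport_conv_four]
    simp only [show (4:ℕ) ≠ 0 from by norm_num, show (4:ℕ) ≠ 1 from by norm_num, show (4:ℕ) ≠ 2 from by norm_num,
      show (4:ℕ) ≠ 3 from by norm_num, if_false, if_true]


section General

variable {G : GeoConsts} {Q : EngConsts} {R : RenConsts} (hR : ∀ j, 0 ≤ R.Gfr j) (hGS : ∀ k, 0 ≤ G.S k) (hQS : ∀ k, 0 ≤ Q.S' k)
  {c U β μ : ℝ} (hc : 0 < c) (hcle : c ≤ klCurveC3 R) (hU : 0 < U) (hUle : U ≤ klCurveU0 R)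
  (hG34U : 2 * (R.Gfr 3 + R.Gfr 4) * U ^ 2 ≤ 1)
  (hβmin : klBetaMin ≤ β) (hβc : β ≤ Real.exp (c / U ^ 2)) (hμ : μ ∈ klWindowC) {n : ℕ} (hn : n ≤ nScales β)
  (hK₀ : FrameOK R U n μ (klFlowFrameU L M β U μ n)) (hK : FrameOK R U n μ (klFlowFrameU L M β U μ (n + 1)))
  {X : ℝ} (hX : ∀ l ≤ 4, ∀ x : ℝ, ‖iteratedFDeriv ℝ l salmhoferCutoff x‖ ≤ X)
  {n' : ℕ} (hP : ∀ m ≤ n', FlowPieceJetsAt L M β U μ R m) (hT : ∀ m ≤ n', TwoLegReadJetsF L M G Q β U μ m) (hnn' : n ≤ n')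
  (hLdeg : 4 * klFlowDeg (n + 1) ≤ L)
  {z : ℕ → ℝ} {m : ℕ → ℝ} (hm : ∀ j, 0 ≤ m j)

section AtN

variable (hZ : TwoLegDualSpaceMomentsUpToAt L M (klZspLaw z U n) β U μ n 5)
  (hm1 : 4 / 3 * R.Gfr 1 + 2 * z 1 ≤ m 1) (hm2 : R.Gfr 2 + 2 * z 2 ≤ m 2) (hm3 : R.Gfr 3 / 3 + 2 * z 3 ≤ m 3)
  (hm4 : R.Gfr 4 / 15 + 2 * z 4 ≤ m 4) (hm5 : 2 ^ 5 * (Real.pi ^ 8 / 4 * 2 ^ 4 * (2 : ℝ) ^ 32) * (curveExtC X G.S 1 + curveExtC X Q.S' 1 * |U|) / 63 + 2 * z 5 ≤ m 5)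
include hR hGS hQS hc hcle hU hUle hG34U hβmin hβc hμ hn hK₀ hK hX hP hT hnn' hLdeg hm hZ hm1 hm2 hm3 hm4 hm5

/-- **«(C2)-ONE-CALL», GENERAL STEP, L2 PRICING — `transport_jets_flow_fit_of_spaceMoments_l2`** (as the OneCall twin, table with `2` for
`(1 + 2(Gfr₃+Gfr₄))`, extra hypothesis `2(Gfr₃+Gfr₄)U² ≤ 1`): the LITERAL `(hTdiff, hT)` pair of `twoLegReadPriv_flow_succ` at scale `n`
(`eT = 0`; `eT′` = `transport_jets_flow_fit`'s table in `m`) from the regime, the two `FrameOK`s at depth `n`, the flow history, the (P)-step's degree guard, the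
#17 export at `(K_n, n)` and five n-free rows `aF_j + 2·z j ≤ m j`. [cite: BenfattoGiulianiMastropietro2006, §2.4 Lemma 2.1 (2.40)] -/
theorem transport_jets_flow_fit_of_spaceMoments_l2 :
    ContDiff ℝ 4 (fun θ : ℝ =>
      (symInterp L (klLocSelfEnergyRe L M β U μ (klFlowFrameU L M β U μ n) n)).eval (klFermiPoint μ (klFlowFrameU L M β U μ (n + 1)) θ) -
        klLocalPart L M β U μ (klFlowFrameU L M β U μ n) n θ) ∧
    ∀ k ≤ 4, ∀ θ : ℝ, |iteratedDeriv k (fun θ : ℝ =>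
      (symInterp L (klLocSelfEnergyRe L M β U μ (klFlowFrameU L M β U μ n) n)).eval (klFermiPoint μ (klFlowFrameU L M β U μ (n + 1)) θ) -
        klLocalPart L M β U μ (klFlowFrameU L M β U μ n) n θ) θ| ≤
      curveJetBar (fun _ => 0)
        (fun k : ℕ =>
          if k = 0 then 16 * ((12.2 * R.Gfr 0 * m 1))
          else if k = 1 then 4 * ((1420 * 2 * (R.Gfr 1 + R.Gfr 2 + R.Gfr 3 + R.Gfr 4) * 2 * m 1) + (36400 * R.Gfr 0 * m 1) + (2820 * R.Gfr 0 * m 2))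
          else if k = 2 then ((12900000 * 2 ^ 2 * (R.Gfr 1 + R.Gfr 2 + R.Gfr 3 + R.Gfr 4) * 2 ^ 2 * m 1) + (657000 * 2 * (R.Gfr 1 + R.Gfr 2 + R.Gfr 3 + R.Gfr 4) * 2 * m 2) + (338000000 * 2 * R.Gfr 0 * 2 * m 1) + (25400000 * R.Gfr 0 * m 2) + (652000 * R.Gfr 0 * m 3))
          else if k = 3 then ((199000000000 * 2 ^ 3 * (R.Gfr 1 + R.Gfr 2 + R.Gfr 3 + R.Gfr 4) * 2 ^ 3 * m 1) + (12000000000 * 2 ^ 2 * (R.Gfr 1 + R.Gfr 2 + R.Gfr 3 + R.Gfr 4) * 2 ^ 2 * m 2) + (228000000 * 2 * (R.Gfr 1 + R.Gfr 2 + R.Gfr 3 + R.Gfr 4) * 2 * m 3) + (5230000000000 * 2 ^ 2 * R.Gfr 0 * 2 ^ 2 * m 1) + (392000000000 * 2 * R.Gfr 0 * 2 * m 2) + (11800000000 * R.Gfr 0 * m 3) + (151000000 * R.Gfr 0 * m 4)) / 4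
          else if k = 4 then ((4300000000000000 * 2 ^ 4 * (R.Gfr 1 + R.Gfr 2 + R.Gfr 3 + R.Gfr 4) * 2 ^ 4 * m 1) + (276000000000000 * 2 ^ 3 * (R.Gfr 1 + R.Gfr 2 + R.Gfr 3 + R.Gfr 4) * 2 ^ 3 * m 2) + (6890000000000 * 2 ^ 2 * (R.Gfr 1 + R.Gfr 2 + R.Gfr 3 + R.Gfr 4) * 2 ^ 2 * m 3) + (70100000000 * 2 * (R.Gfr 1 + R.Gfr 2 + R.Gfr 3 + R.Gfr 4) * 2 * m 4) + (114000000000000000 * 2 ^ 2 * R.Gfr 0 * 2 ^ 2 * m 1) + (8490000000000000 * 2 ^ 2 * R.Gfr 0 * 2 ^ 2 * m 2) + (272000000000000 * 2 * R.Gfr 0 * 2 * m 3) + (4530000000000 * R.Gfr 0 * m 4) + (34800000000 * R.Gfr 0 * m 5) + (69200000000 * (16 / 15) * R.Gfr 4 * m 1)) / 16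
          else 0)
        U k (n + 1) := by
  obtain ⟨hdeg, -⟩ := degree_klFlowFrameU_le_half (L := L) (M := M) (β := β) (U := U) (μ := μ) (n := n) hLdeg
  have hβ0 : 0 < β := KLRegimeSplit.pos_of_klBetaMin_le hβmin
  have ha := flowFrame_jets_lawA (L := L) (M := M) hR hGS hQS hμ hX hP hT (n := n) (by omega)
  have hb := sep_jets_of_twoLegDualSpaceMomentsUpToAt hβ0 hZ
  obtain ⟨hM₁, hM₂, hM₃, hM₄, hM₅⟩ := cumulativeSymbol_nested_sizes_of_split (L := L) (M := M) β U μ hdeg n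
    (a := fun j => (if j = 1 then 4 / 3 * R.Gfr 1 * U ^ 2 * ((4 : ℝ) ^ n) ^ 0 else if j = 2 then R.Gfr 2 * U ^ 2 * ((4 : ℝ) ^ n) ^ 1 else if j = 3 then R.Gfr 3 / 3 * U ^ 2 * ((4 : ℝ) ^ n) ^ 2 else if j = 4 then R.Gfr 4 / 15 * U ^ 2 * ((4 : ℝ) ^ n) ^ 3 else 2 ^ 5 * (Real.pi ^ 8 / 4 * 2 ^ 4 * (2 : ℝ) ^ 32) * (curveExtC X G.S 1 + curveExtC X Q.S' 1 * |U|) / 63 * U ^ 2 * ((4 : ℝ) ^ n) ^ 4))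
    (b := fun j => 2 * klZspLaw z U n j) ha hb
  have hF := cumulativeSymbol_contDiff (L := L) (M := M) β U μ (klFlowFrameU L M β U μ n) n (k := 5)
  have hw : ∀ p : ℕ, 0 ≤ U ^ 2 * ((4 : ℝ) ^ n) ^ p := fun p => by positivity
  have hlaw1 : (if (1 : ℕ) = 1 then 4 / 3 * R.Gfr 1 * U ^ 2 * ((4 : ℝ) ^ n) ^ 0 else if (1 : ℕ) = 2 then R.Gfr 2 * U ^ 2 * ((4 : ℝ) ^ n) ^ 1 else if (1 : ℕ) = 3 then R.Gfr 3 / 3 * U ^ 2 * ((4 : ℝ) ^ n) ^ 2 else if (1 : ℕ) = 4 then R.Gfr 4 / 15 * U ^ 2 * ((4 : ℝ) ^ n) ^ 3 else 2 ^ 5 * (Real.pi ^ 8 / 4 * 2 ^ 4 * (2 : ℝ) ^ 32) * (curveExtC X G.S 1 + curveExtC X Q.S' 1 * |U|) / 63 * U ^ 2 * ((4 : ℝ) ^ n) ^ 4) + 2 * klZspLaw z U n 1 ≤ m 1 * U ^ 2 * ((4 : ℝ) ^ n) ^ 0 := by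
    rw [if_pos rfl, two_mul_klZspLaw, show (1 : ℕ) - 1 = 0 from rfl]
    calc _ = (4 / 3 * R.Gfr 1 + 2 * z 1) * (U ^ 2 * ((4 : ℝ) ^ n) ^ 0) := by ring
      _ ≤ m 1 * (U ^ 2 * ((4 : ℝ) ^ n) ^ 0) := mul_le_mul_of_nonneg_right hm1 (hw 0)
      _ = m 1 * U ^ 2 * ((4 : ℝ) ^ n) ^ 0 := by ring
  have hlaw2 : (if (2 : ℕ) = 1 then 4 / 3 * R.Gfr 1 * U ^ 2 * ((4 : ℝ) ^ n) ^ 0 else if (2 : ℕ) = 2 then R.Gfr 2 * U ^ 2 * ((4 : ℝ) ^ n) ^ 1 else if (2 : ℕ) = 3 then R.Gfr 3 / 3 * U ^ 2 * ((4 : ℝ) ^ n) ^ 2 else if (2 : ℕ) = 4 then R.Gfr 4 / 15 * U ^ 2 * ((4 : ℝ) ^ n) ^ 3 else 2 ^ 5 * (Real.pi ^ 8 / 4 * 2 ^ 4 * (2 : ℝ) ^ 32) * (curveExtC X G.S 1 + curveExtC X Q.S' 1 * |U|) / 63 * U ^ 2 * ((4 : ℝ) ^ n) ^ 4) + 2 *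 klZspLaw z U n 2 ≤ m 2 * U ^ 2 * ((4 : ℝ) ^ n) ^ 1 := by
    rw [if_neg (by norm_num), if_pos rfl, two_mul_klZspLaw, show (2 : ℕ) - 1 = 1 from rfl]
    calc _ = (R.Gfr 2 + 2 * z 2) * (U ^ 2 * ((4 : ℝ) ^ n) ^ 1) := by ring
      _ ≤ m 2 * (U ^ 2 * ((4 : ℝ) ^ n) ^ 1) := mul_le_mul_of_nonneg_right hm2 (hw 1)
      _ = m 2 * U ^ 2 * ((4 : ℝ) ^ n) ^ 1 := by ring
  have hlaw3 : (if (3 : ℕ) = 1 then 4 / 3 * R.Gfr 1 * U ^ 2 * ((4 : ℝ) ^ n) ^ 0 else if (3 : ℕ) = 2 then R.Gfr 2 * U ^ 2 * ((4 : ℝ) ^ n) ^ 1 else if (3 : ℕ) = 3 then R.Gfr 3 / 3 * U ^ 2 * ((4 : ℝ) ^ n) ^ 2 else if (3 : ℕ) = 4 then R.Gfr 4 / 15 * U ^ 2 * ((4 : ℝ) ^ n) ^ 3 else 2 ^ 5 * (Real.pi ^ 8 / 4 * 2 ^ 4 * (2 : ℝ) ^ 32) * (curveExtC X G.S 1 +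 curveExtC X Q.S' 1 * |U|) / 63 * U ^ 2 * ((4 : ℝ) ^ n) ^ 4) + 2 * klZspLaw z U n 3 ≤ m 3 * U ^ 2 * ((4 : ℝ) ^ n) ^ 2 := by
    rw [if_neg (by norm_num), if_neg (by norm_num), if_pos rfl, two_mul_klZspLaw, show (3 : ℕ) - 1 = 2 from rfl]
    calc _ = (R.Gfr 3 / 3 + 2 * z 3) * (U ^ 2 * ((4 : ℝ) ^ n) ^ 2) := by ring
      _ ≤ m 3 * (U ^ 2 * ((4 : ℝ) ^ n) ^ 2) := mul_le_mul_of_nonneg_right hm3 (hw 2)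
      _ = m 3 * U ^ 2 * ((4 : ℝ) ^ n) ^ 2 := by ring
  have hlaw4 : (if (4 : ℕ) = 1 then 4 / 3 * R.Gfr 1 * U ^ 2 * ((4 : ℝ) ^ n) ^ 0 else if (4 : ℕ) = 2 then R.Gfr 2 * U ^ 2 * ((4 : ℝ) ^ n) ^ 1 else if (4 : ℕ) = 3 then R.Gfr 3 / 3 * U ^ 2 * ((4 : ℝ) ^ n) ^ 2 else if (4 : ℕ) = 4 then R.Gfr 4 / 15 * U ^ 2 * ((4 : ℝ) ^ n) ^ 3 else 2 ^ 5 * (Real.pi ^ 8 / 4 * 2 ^ 4 * (2 : ℝ) ^ 32) * (curveExtC X G.S 1 + curveExtC X Q.S' 1 * |U|) / 63 * U ^ 2 * ((4 : ℝ) ^ n) ^ 4) + 2 * klZspLaw z U n 4 ≤ m 4 * U ^ 2 * ((4 : ℝ) ^ n) ^ 3 := by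
    rw [if_neg (by norm_num), if_neg (by norm_num), if_neg (by norm_num), if_pos rfl, two_mul_klZspLaw, show (4 : ℕ) - 1 = 3 from rfl]
    calc _ = (R.Gfr 4 / 15 + 2 * z 4) * (U ^ 2 * ((4 : ℝ) ^ n) ^ 3) := by ring
      _ ≤ m 4 * (U ^ 2 * ((4 : ℝ) ^ n) ^ 3) := mul_le_mul_of_nonneg_right hm4 (hw 3)
      _ = m 4 * U ^ 2 * ((4 : ℝ) ^ n) ^ 3 := by ring
  have hlaw5 : (if (5 : ℕ) = 1 then 4 / 3 * R.Gfr 1 * U ^ 2 * ((4 : ℝ) ^ n) ^ 0 else if (5 : ℕ) = 2 then R.Gfr 2 * U ^ 2 * ((4 : ℝ) ^ n) ^ 1 else if (5 : ℕ) = 3 then R.Gfr 3 / 3 * U ^ 2 * ((4 : ℝ) ^ n) ^ 2 else if (5 : ℕ) = 4 then R.Gfr 4 / 15 * U ^ 2 * ((4 : ℝ) ^ n) ^ 3 else 2 ^ 5 * (Real.pi ^ 8 / 4 * 2 ^ 4 * (2 : ℝ) ^ 32) * (curveExtC X G.S 1 + curveExtC X Q.S' 1 * |U|) / 63 * U ^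 2 * ((4 : ℝ) ^ n) ^ 4) + 2 * klZspLaw z U n 5 ≤ m 5 * U ^ 2 * ((4 : ℝ) ^ n) ^ 4 := by
    rw [if_neg (by norm_num), if_neg (by norm_num), if_neg (by norm_num), if_neg (by norm_num), two_mul_klZspLaw, show (5 : ℕ) - 1 = 4 from rfl]
    calc _ = (2 ^ 5 * (Real.pi ^ 8 / 4 * 2 ^ 4 * (2 : ℝ) ^ 32) * (curveExtC X G.S 1 + curveExtC X Q.S' 1 * |U|) / 63 + 2 * z 5) * (U ^ 2 * ((4 : ℝ) ^ n) ^ 4) := by ring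
      _ ≤ m 5 * (U ^ 2 * ((4 : ℝ) ^ n) ^ 4) := mul_le_mul_of_nonneg_right hm5 (hw 4)
      _ = m 5 * U ^ 2 * ((4 : ℝ) ^ n) ^ 4 := by ring
  obtain ⟨hl1, hA3, hA4, hh0, hhη⟩ := flow_graded_params hR U n
  have hη_nn : 0 ≤ (R.Gfr 1 + R.Gfr 2 + R.Gfr 3 + R.Gfr 4) * U ^ 2 * ((4 : ℝ) ^ (2 * n))⁻¹ := by
    have := hR 1; have := hR 2; have := hR 3; have := hR 4; positivity
  have hη₀_nn : 0 ≤ R.Gfr 0 * |U| * ((4 : ℝ) ^ (2 * n))⁻¹ := by have := hR 0; positivity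
  obtain ⟨hdiff, hrows⟩ := transport_jets_flow hR hc hcle hU hUle hβmin hβc hμ hn hK₀ hK (hP n hnn') hη_nn hη₀_nn hl1 hA3 hA4 hh0 hhη hF
    hM₁ hM₂ hM₃ hM₄ hM₅
  refine ⟨hdiff, fun k hk θ => ?_⟩
  obtain ⟨r0, r1, r2, r3, r4⟩ := hrows θ
  have hU1 : U ≤ 1 := hUle.trans (klCurveU0_le_one R)
  have hM1' := by have h := hM₁ 0; exact le_trans (by positivity) h
  have hM2' := by have h := hM₂ 0; exact le_trans (by positivity) h
  have hM3' := by have h := hM₃ 0; exact le_trans (by positivity) h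
  have hM4' := by have h := hM₄ 0; exact le_trans (by positivity) h
  have hM5' := by have h := hM₅ 0; exact le_trans (by positivity) h
  exact (transport_rows_fit_l2 hR hU hU1 hG34U n hM1' hM2' hM3' hM4' hM5' hm hlaw1 hlaw2 hlaw3 hlaw4 hlaw5
    (D := fun k => |iteratedDeriv k (fun θ : ℝ =>
      (symInterp L (klLocSelfEnergyRe L M β U μ (klFlowFrameU L M β U μ n) n)).eval (klFermiPoint μ (klFlowFrameU L M β U μ (n + 1)) θ) -
        klLocalPart L M β U μ (klFlowFrameU L M β U μ n) n θ) θ|) r0 r1 r2 r3 r4 k hk)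

end AtN

section AtSucc

variable (hz : ∀ j, 0 ≤ z j) (hZ' : TwoLegDualSpaceMomentsUpToAt L M (klZspLaw z U (n + 1)) β U μ (n + 1) 5)
  (hl1 : 4 / 3 * R.Gfr 1 + 2 * z 1 ≤ m 1) (hl2 : R.Gfr 2 + 8 * z 2 ≤ m 2) (hl3 : R.Gfr 3 / 3 + 32 * z 3 ≤ m 3)
  (hl4 : R.Gfr 4 / 15 + 128 * z 4 ≤ m 4) (hl5 : 2 ^ 5 * (Real.pi ^ 8 / 4 * 2 ^ 4 * (2 : ℝ) ^ 32) * (curveExtC X G.S 1 + curveExtC X Q.S' 1 * |U|) / 63 + 512 * z 5 ≤ m 5)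
include hR hGS hQS hc hcle hU hUle hG34U hβmin hβc hμ hn hK₀ hK hX hP hT hnn' hLdeg hz hm hZ' hl1 hl2 hl3 hl4 hl5

/-! ## §3 The last index, L2 pricing -/

/-- **«(C2)-ONE-CALL», LAST INDEX, L2 PRICING — `transport_last_flow_fit_of_spaceMoments_l2`** (table with `2` for `(1 + 2(Gfr₃+Gfr₄))`): the LITERAL `(hTdiff, hT)` pair of `twoLegReadPriv_flow_succ_of_swap_lit`
(= `hTrdiff/hTr` of `twoLegRead_flow_last_registered_of_pos` at `n = n_β`) with `eT = 0` and the SAME `eT′` table in `m`: the symbol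
`SI(σ^{K_{n+1}}_{n+1}).eval + (klFlowPiece n).eval = evalM K_n + evalM SI(S̃_{n+1}[K_{n+1}])` is transported between the Fermi points of `K_{n+1} = K_n ⊖ p_n` and `K_n`
by `transport_jets_of_frameOK_fun`; sizes = frame jets of `K_n` (law A at base `4ⁿ`) + the #17 export at `(K_{n+1}, n+1)` (rows `aF_j + 2·4^{j−1}·z j ≤ m j`).
[cite: BenfattoGiulianiMastropietro2006, §2.4 Lemma 2.1 (2.40)] -/
theorem transport_last_flow_fit_of_spaceMoments_l2 :
    ContDiff ℝ 4 (fun θ : ℝ =>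
      ((symInterp L (klLocSelfEnergyRe L M β U μ (klFlowFrameU L M β U μ (n + 1)) (n + 1))).eval
            (klFermiPoint μ (klFlowFrameU L M β U μ (n + 1)) θ) +
          (klFlowPiece L M β U μ n).eval (klFermiPoint μ (klFlowFrameU L M β U μ (n + 1)) θ)) -
        ((symInterp L (klLocSelfEnergyRe L M β U μ (klFlowFrameU L M β U μ (n + 1)) (n + 1))).eval
            (klFermiPoint μ (klFlowFrameU L M β U μ n) θ) +
          (klFlowPiece L M β U μ n).eval (klFermiPoint μ (klFlowFrameU L M β U μ n) θ))) ∧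
    ∀ k ≤ 4, ∀ θ : ℝ, |iteratedDeriv k (fun θ : ℝ =>
      ((symInterp L (klLocSelfEnergyRe L M β U μ (klFlowFrameU L M β U μ (n + 1)) (n + 1))).eval
            (klFermiPoint μ (klFlowFrameU L M β U μ (n + 1)) θ) +
          (klFlowPiece L M β U μ n).eval (klFermiPoint μ (klFlowFrameU L M β U μ (n + 1)) θ)) -
        ((symInterp L (klLocSelfEnergyRe L M β U μ (klFlowFrameU L M β U μ (n + 1)) (n + 1))).eval
            (klFermiPoint μ (klFlowFrameU L M β U μ n) θ) +
          (klFlowPiece L M β U μ n).eval (klFermiPoint μ (klFlowFrameU L M β U μ n) θ))) θ| ≤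
      curveJetBar (fun _ => 0)
        (fun k : ℕ =>
          if k = 0 then 16 * ((12.2 * R.Gfr 0 * m 1))
          else if k = 1 then 4 * ((1420 * 2 * (R.Gfr 1 + R.Gfr 2 + R.Gfr 3 + R.Gfr 4) * 2 * m 1) + (36400 * R.Gfr 0 * m 1) + (2820 * R.Gfr 0 * m 2))
          else if k = 2 then ((12900000 * 2 ^ 2 * (R.Gfr 1 + R.Gfr 2 + R.Gfr 3 + R.Gfr 4) * 2 ^ 2 * m 1) + (657000 * 2 * (R.Gfr 1 + R.Gfr 2 + R.Gfr 3 + R.Gfr 4) * 2 * m 2) + (338000000 * 2 * R.Gfr 0 * 2 * m 1) + (25400000 * R.Gfr 0 * m 2) + (652000 * R.Gfr 0 * m 3))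
          else if k = 3 then ((199000000000 * 2 ^ 3 * (R.Gfr 1 + R.Gfr 2 + R.Gfr 3 + R.Gfr 4) * 2 ^ 3 * m 1) + (12000000000 * 2 ^ 2 * (R.Gfr 1 + R.Gfr 2 + R.Gfr 3 + R.Gfr 4) * 2 ^ 2 * m 2) + (228000000 * 2 * (R.Gfr 1 + R.Gfr 2 + R.Gfr 3 + R.Gfr 4) * 2 * m 3) + (5230000000000 * 2 ^ 2 * R.Gfr 0 * 2 ^ 2 * m 1) + (392000000000 * 2 * R.Gfr 0 * 2 * m 2) + (11800000000 * R.Gfr 0 * m 3) + (151000000 * R.Gfr 0 * m 4)) / 4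
          else if k = 4 then ((4300000000000000 * 2 ^ 4 * (R.Gfr 1 + R.Gfr 2 + R.Gfr 3 + R.Gfr 4) * 2 ^ 4 * m 1) + (276000000000000 * 2 ^ 3 * (R.Gfr 1 + R.Gfr 2 + R.Gfr 3 + R.Gfr 4) * 2 ^ 3 * m 2) + (6890000000000 * 2 ^ 2 * (R.Gfr 1 + R.Gfr 2 + R.Gfr 3 + R.Gfr 4) * 2 ^ 2 * m 3) + (70100000000 * 2 * (R.Gfr 1 + R.Gfr 2 + R.Gfr 3 + R.Gfr 4) * 2 * m 4) + (114000000000000000 * 2 ^ 2 * R.Gfr 0 * 2 ^ 2 * m 1) + (8490000000000000 * 2 ^ 2 * R.Gfr 0 * 2 ^ 2 * m 2) + (272000000000000 * 2 * R.Gfr 0 * 2 * m 3) + (4530000000000 * R.Gfr 0 * m 4) + (34800000000 * R.Gfr 0 * m 5) + (69200000000 * (16 / 15) * R.Gfr 4 * m 1)) / 16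
          else 0)
        U k (n + 1) := by
  obtain ⟨-, hdeg1⟩ := degree_klFlowFrameU_le_half (L := L) (M := M) (β := β) (U := U) (μ := μ) (n := n) hLdeg
  have hβ0 : 0 < β := KLRegimeSplit.pos_of_klBetaMin_le hβmin
  have hU1 : U ≤ 1 := hUle.trans (klCurveU0_le_one R)
  have hx : (1 : ℝ) ≤ (4 : ℝ) ^ n := one_le_pow₀ (by norm_num)
  -- (a) frame jets of `K_n`, (b) separated jets at `(K_{n+1}, n+1)` from the export
  have ha := flowFrame_jets_lawA (L := L) (M := M) hR hGS hQS hμ hX hP hT (n := n) (by omega)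
  have hb := sep_jets_of_twoLegDualSpaceMomentsUpToAt hβ0 hZ'
  -- the symbol equals `evalM K_n + evalM SI(S̃_{n+1})`
  have hFsplit : (fun q : Momentum => (symInterp L (klLocSelfEnergyRe L M β U μ (klFlowFrameU L M β U μ (n + 1)) (n + 1))).eval (WithLp.ofLp q) + (klFlowPiece L M β U μ n).eval (WithLp.ofLp q)) =
      fun q : Momentum => evalM (klFlowFrameU L M β U μ n) q + evalM (symInterp L (fun k => klLocSelfEnergyRe L M β U μ (klFlowFrameU L M β U μ (n + 1)) (n + 1) k - (klFlowFrameU L M β U μ (n + 1)).eval (latticeMomentum L k))) q := by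
    have hs := cumulativeSymbol_eq_frame_add_sep (L := L) (M := M) β U μ hdeg1 (n + 1)
    funext q
    have hq : (symInterp L (klLocSelfEnergyRe L M β U μ (klFlowFrameU L M β U μ (n + 1)) (n + 1))).eval (WithLp.ofLp q) =
        evalM (klFlowFrameU L M β U μ (n + 1)) q + evalM (symInterp L (fun k => klLocSelfEnergyRe L M β U μ (klFlowFrameU L M β U μ (n + 1)) (n + 1) k - (klFlowFrameU L M β U μ (n + 1)).eval (latticeMomentum L k))) q := congrFun hs q
    have hKq : evalM (klFlowFrameU L M β U μ (n + 1)) q + (klFlowPiece L M β U μ n).eval (WithLp.ofLp q) = evalM (klFlowFrameU L M β U μ n) q := by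
      rw [klFlowFrameU_succ]; simp only [evalM, eval_fsub]; ring
    show (symInterp L (klLocSelfEnergyRe L M β U μ (klFlowFrameU L M β U μ (n + 1)) (n + 1))).eval (WithLp.ofLp q) + (klFlowPiece L M β U μ n).eval (WithLp.ofLp q) =
      evalM (klFlowFrameU L M β U μ n) q + evalM (symInterp L (fun k => klLocSelfEnergyRe L M β U μ (klFlowFrameU L M β U μ (n + 1)) (n + 1) k - (klFlowFrameU L M β U μ (n + 1)).eval (latticeMomentum L k))) q
    rw [hq]
    linarith
  have hj : ∀ j, 1 ≤ j → j ≤ 5 → ∀ q : Momentum, ‖iteratedFDeriv ℝ j (fun q : Momentum => (symInterp L (klLocSelfEnergyRe L M β U μ (klFlowFrameU L M β U μ (n + 1)) (n + 1))).eval (WithLp.ofLp q) + (klFlowPiece L M β U μ n).eval (WithLp.ofLp q)) q‖ ≤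
      (if j = 1 then 4 / 3 * R.Gfr 1 * U ^ 2 * ((4 : ℝ) ^ n) ^ 0 else if j = 2 then R.Gfr 2 * U ^ 2 * ((4 : ℝ) ^ n) ^ 1 else if j = 3 then R.Gfr 3 / 3 * U ^ 2 * ((4 : ℝ) ^ n) ^ 2 else if j = 4 then R.Gfr 4 / 15 * U ^ 2 * ((4 : ℝ) ^ n) ^ 3 else 2 ^ 5 * (Real.pi ^ 8 / 4 * 2 ^ 4 * (2 : ℝ) ^ 32) * (curveExtC X G.S 1 + curveExtC X Q.S' 1 * |U|) / 63 * U ^ 2 * ((4 : ℝ) ^ n) ^ 4) + 2 * klZspLaw z U (n + 1) j := by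
    rw [hFsplit]
    exact jets_evalM_add_evalM (a := fun j => (if j = 1 then 4 / 3 * R.Gfr 1 * U ^ 2 * ((4 : ℝ) ^ n) ^ 0 else if j = 2 then R.Gfr 2 * U ^ 2 * ((4 : ℝ) ^ n) ^ 1 else if j = 3 then R.Gfr 3 / 3 * U ^ 2 * ((4 : ℝ) ^ n) ^ 2 else if j = 4 then R.Gfr 4 / 15 * U ^ 2 * ((4 : ℝ) ^ n) ^ 3 else 2 ^ 5 * (Real.pi ^ 8 / 4 * 2 ^ 4 * (2 : ℝ) ^ 32) * (curveExtC X G.S 1 + curveExtC X Q.S' 1 * |U|) / 63 * U ^ 2 * ((4 : ℝ) ^ n) ^ 4)) (b := fun j => 2 * klZspLaw z U (n + 1) j) ha hb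
  obtain ⟨hM₁, hM₂, hM₃, hM₄, hM₅⟩ := nested_five_of_jets hj
  have hF5 : ContDiff ℝ 5 (fun q : Momentum => (symInterp L (klLocSelfEnergyRe L M β U μ (klFlowFrameU L M β U μ (n + 1)) (n + 1))).eval (WithLp.ofLp q) + (klFlowPiece L M β U μ n).eval (WithLp.ofLp q)) :=
    (cumulativeSymbol_contDiff (L := L) (M := M) β U μ (klFlowFrameU L M β U μ (n + 1)) (n + 1) (k := 5)).add (contDiff_evalM (klFlowPiece L M β U μ n))
  -- the door at `(K₀, p, n) := (K_n, p_n, n)` with the canonical graded parameters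
  obtain ⟨hl1', hA3, hA4, hh0, hhη⟩ := flow_graded_params hR U n
  have hη_nn : 0 ≤ (R.Gfr 1 + R.Gfr 2 + R.Gfr 3 + R.Gfr 4) * U ^ 2 * ((4 : ℝ) ^ (2 * n))⁻¹ := by
    have := hR 1; have := hR 2; have := hR 3; have := hR 4; positivity
  have hη₀_nn : 0 ≤ R.Gfr 0 * |U| * ((4 : ℝ) ^ (2 * n))⁻¹ := by have := hR 0; positivity
  have hK' : FrameOK R U n μ (fsub (klFlowFrameU L M β U μ n) (klFlowPiece L M β U μ n)) := by
    rw [← klFlowFrameU_succ]; exact hK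
  obtain ⟨hdiff, hrows⟩ := transport_jets_of_frameOK_fun hR hc hcle hU hUle hβmin hβc hμ hn hK₀ hK' (hP n hnn') hη_nn hη₀_nn hl1' hA3 hA4 hh0 hhη
    hF5 hM₁ hM₂ hM₃ hM₄ hM₅
  have hfun : (fun θ : ℝ =>
      ((symInterp L (klLocSelfEnergyRe L M β U μ (klFlowFrameU L M β U μ (n + 1)) (n + 1))).eval
            (klFermiPoint μ (klFlowFrameU L M β U μ (n + 1)) θ) +
          (klFlowPiece L M β U μ n).eval (klFermiPoint μ (klFlowFrameU L M β U μ (n + 1)) θ)) -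
        ((symInterp L (klLocSelfEnergyRe L M β U μ (klFlowFrameU L M β U μ (n + 1)) (n + 1))).eval
            (klFermiPoint μ (klFlowFrameU L M β U μ n) θ) +
          (klFlowPiece L M β U μ n).eval (klFermiPoint μ (klFlowFrameU L M β U μ n) θ))) =
      fun θ : ℝ =>
        (fun q : Momentum => (symInterp L (klLocSelfEnergyRe L M β U μ (klFlowFrameU L M β U μ (n + 1)) (n + 1))).eval (WithLp.ofLp q) + (klFlowPiece L M β U μ n).eval (WithLp.ofLp q))
            (WithLp.toLp 2 (klFermiPoint μ (fsub (klFlowFrameU L M β U μ n) (klFlowPiece L M β U μ n)) θ)) -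
          (fun q : Momentum => (symInterp L (klLocSelfEnergyRe L M β U μ (klFlowFrameU L M β U μ (n + 1)) (n + 1))).eval (WithLp.ofLp q) + (klFlowPiece L M β U μ n).eval (WithLp.ofLp q))
            (WithLp.toLp 2 (klFermiPoint μ (klFlowFrameU L M β U μ n) θ)) := by
    funext θ
    simp only [klFlowFrameU_succ]
  rw [hfun]
  refine ⟨hdiff, fun k hk θ => ?_⟩
  obtain ⟨r0, r1, r2, r3, r4⟩ := hrows θ
  -- nonnegativity of the five sizes and the moment law at base `4ⁿ`
  have hX0 : 0 ≤ X := (norm_nonneg _).trans (hX 0 (by norm_num) 0)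
  have hW : 0 ≤ (curveExtC X G.S 1 + curveExtC X Q.S' 1 * |U|) := by
    have hc1 := curveExtC_nonneg hX0 hGS 1
    have hc2 := curveExtC_nonneg hX0 hQS 1
    positivity
  have hw : ∀ p : ℕ, 0 ≤ U ^ 2 * ((4 : ℝ) ^ n) ^ p := fun p => by positivity
  have hzl : ∀ j, 0 ≤ 2 * klZspLaw z U (n + 1) j := fun j => by
    have := klZspLaw_nonneg hz U (n + 1) j; linarith
  have hG1 := hR 1; have hG2 := hR 2; have hG3 := hR 3; have hG4 := hR 4
  have hM1' : 0 ≤ (if (1 : ℕ) = 1 then 4 / 3 * R.Gfr 1 * U ^ 2 * ((4 : ℝ) ^ n) ^ 0 else if (1 : ℕ) = 2 then R.Gfr 2 * U ^ 2 * ((4 : ℝ) ^ n) ^ 1 else if (1 : ℕ) = 3 then R.Gfr 3 / 3 * U ^ 2 * ((4 : ℝ) ^ n) ^ 2 else if (1 : ℕ) = 4 then R.Gfr 4 / 15 * U ^ 2 * ((4 : ℝ) ^ n) ^ 3 else 2 ^ 5 * (Real.pi ^ 8 / 4 * 2 ^ 4 * (2 : ℝ) ^ 32) * (curveExtC X G.S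 1 + curveExtC X Q.S' 1 * |U|) / 63 * U ^ 2 * ((4 : ℝ) ^ n) ^ 4) + 2 * klZspLaw z U (n + 1) 1 := by
    rw [if_pos rfl]; exact add_nonneg (by positivity) (hzl 1)
  have hM2' : 0 ≤ (if (2 : ℕ) = 1 then 4 / 3 * R.Gfr 1 * U ^ 2 * ((4 : ℝ) ^ n) ^ 0 else if (2 : ℕ) = 2 then R.Gfr 2 * U ^ 2 * ((4 : ℝ) ^ n) ^ 1 else if (2 : ℕ) = 3 then R.Gfr 3 / 3 * U ^ 2 * ((4 : ℝ) ^ n) ^ 2 else if (2 : ℕ) = 4 then R.Gfr 4 / 15 * U ^ 2 * ((4 : ℝ) ^ n) ^ 3 else 2 ^ 5 * (Real.pi ^ 8 / 4 * 2 ^ 4 * (2 : ℝ) ^ 32) * (curveExtC X G.S 1 + curveExtC X Q.S' 1 * |U|) / 63 * U ^ 2 * ((4 : ℝ) ^ n) ^ 4) + 2 * klZspLaw z U (n + 1) 2 := by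
    rw [if_neg (by norm_num), if_pos rfl]; exact add_nonneg (by positivity) (hzl 2)
  have hM3' : 0 ≤ (if (3 : ℕ) = 1 then 4 / 3 * R.Gfr 1 * U ^ 2 * ((4 : ℝ) ^ n) ^ 0 else if (3 : ℕ) = 2 then R.Gfr 2 * U ^ 2 * ((4 : ℝ) ^ n) ^ 1 else if (3 : ℕ) = 3 then R.Gfr 3 / 3 * U ^ 2 * ((4 : ℝ) ^ n) ^ 2 else if (3 : ℕ) = 4 then R.Gfr 4 / 15 * U ^ 2 * ((4 : ℝ) ^ n) ^ 3 else 2 ^ 5 * (Real.pi ^ 8 / 4 * 2 ^ 4 * (2 : ℝ) ^ 32) * (curveExtC X G.S 1 + curveExtC X Q.S' 1 * |U|) / 63 * U ^ 2 * ((4 : ℝ) ^ n) ^ 4) + 2 * klZspLaw z U (n + 1) 3 := by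
    rw [if_neg (by norm_num), if_neg (by norm_num), if_pos rfl]; exact add_nonneg (by positivity) (hzl 3)
  have hM4' : 0 ≤ (if (4 : ℕ) = 1 then 4 / 3 * R.Gfr 1 * U ^ 2 * ((4 : ℝ) ^ n) ^ 0 else if (4 : ℕ) = 2 then R.Gfr 2 * U ^ 2 * ((4 : ℝ) ^ n) ^ 1 else if (4 : ℕ) = 3 then R.Gfr 3 / 3 * U ^ 2 * ((4 : ℝ) ^ n) ^ 2 else if (4 : ℕ) = 4 then R.Gfr 4 / 15 * U ^ 2 * ((4 : ℝ) ^ n) ^ 3 else 2 ^ 5 * (Real.pi ^ 8 / 4 * 2 ^ 4 * (2 : ℝ) ^ 32) * (curveExtC X G.S 1 + curveExtC X Q.S' 1 * |U|) / 63 * U ^ 2 * ((4 : ℝ) ^ n) ^ 4) + 2 * klZspLaw z U (n + 1) 4 := by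
    rw [if_neg (by norm_num), if_neg (by norm_num), if_neg (by norm_num), if_pos rfl]; exact add_nonneg (by positivity) (hzl 4)
  have hM5' : 0 ≤ (if (5 : ℕ) = 1 then 4 / 3 * R.Gfr 1 * U ^ 2 * ((4 : ℝ) ^ n) ^ 0 else if (5 : ℕ) = 2 then R.Gfr 2 * U ^ 2 * ((4 : ℝ) ^ n) ^ 1 else if (5 : ℕ) = 3 then R.Gfr 3 / 3 * U ^ 2 * ((4 : ℝ) ^ n) ^ 2 else if (5 : ℕ) = 4 then R.Gfr 4 / 15 * U ^ 2 * ((4 : ℝ) ^ n) ^ 3 else 2 ^ 5 * (Real.pi ^ 8 / 4 * 2 ^ 4 * (2 : ℝ) ^ 32) * (curveExtC X G.S 1 + curveExtC X Q.S' 1 * |U|) / 63 * U ^ 2 * ((4 : ℝ) ^ n) ^ 4) + 2 * klZspLaw z U (n + 1) 5 := by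
    rw [if_neg (by norm_num), if_neg (by norm_num), if_neg (by norm_num), if_neg (by norm_num)]
    exact add_nonneg (mul_nonneg (mul_nonneg (div_nonneg (mul_nonneg (by positivity) hW) (by norm_num)) (sq_nonneg U)) (by positivity)) (hzl 5)
  have hlaw1 : (if (1 : ℕ) = 1 then 4 / 3 * R.Gfr 1 * U ^ 2 * ((4 : ℝ) ^ n) ^ 0 else if (1 : ℕ) = 2 then R.Gfr 2 * U ^ 2 * ((4 : ℝ) ^ n) ^ 1 else if (1 : ℕ) = 3 then R.Gfr 3 / 3 * U ^ 2 * ((4 : ℝ) ^ n) ^ 2 else if (1 : ℕ) = 4 then R.Gfr 4 / 15 * U ^ 2 * ((4 : ℝ) ^ n) ^ 3 else 2 ^ 5 * (Real.pi ^ 8 / 4 * 2 ^ 4 * (2 : ℝ) ^ 32) * (curveExtC X G.S 1 + curveExtC X Q.S' 1 * |U|) / 63 * U ^ 2 * ((4 : ℝ) ^ n) ^ 4) + 2 * klZspLaw z U (n + 1) 1 ≤ m 1 * U ^ 2 * ((4 : ℝ) ^ n) ^ 0 := by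
    rw [if_pos rfl, two_mul_klZspLaw, show (1 : ℕ) - 1 = 0 from rfl, pow_succ (4 : ℝ) n]
    calc _ = (4 / 3 * R.Gfr 1 + 2 * z 1) * (U ^ 2 * ((4 : ℝ) ^ n) ^ 0) := by ring
      _ ≤ m 1 * (U ^ 2 * ((4 : ℝ) ^ n) ^ 0) := mul_le_mul_of_nonneg_right hl1 (hw 0)
      _ = m 1 * U ^ 2 * ((4 : ℝ) ^ n) ^ 0 := by ring
  have hlaw2 : (if (2 : ℕ) = 1 then 4 / 3 * R.Gfr 1 * U ^ 2 * ((4 : ℝ) ^ n) ^ 0 else if (2 : ℕ) = 2 then R.Gfr 2 * U ^ 2 * ((4 : ℝ) ^ n) ^ 1 else if (2 : ℕ) = 3 then R.Gfr 3 / 3 * U ^ 2 * ((4 : ℝ) ^ n) ^ 2 else if (2 : ℕ) = 4 then R.Gfr 4 / 15 * U ^ 2 * ((4 : ℝ) ^ n) ^ 3 else 2 ^ 5 * (Real.pi ^ 8 / 4 * 2 ^ 4 * (2 : ℝ) ^ 32) * (curveExtC X G.S 1 + curveExtC X Q.S' 1 * |U|) / 63 * U ^ 2 * ((4 : ℝ)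 ^ n) ^ 4) + 2 * klZspLaw z U (n + 1) 2 ≤ m 2 * U ^ 2 * ((4 : ℝ) ^ n) ^ 1 := by
    rw [if_neg (by norm_num), if_pos rfl, two_mul_klZspLaw, show (2 : ℕ) - 1 = 1 from rfl, pow_succ (4 : ℝ) n]
    calc _ = (R.Gfr 2 + 8 * z 2) * (U ^ 2 * ((4 : ℝ) ^ n) ^ 1) := by ring
      _ ≤ m 2 * (U ^ 2 * ((4 : ℝ) ^ n) ^ 1) := mul_le_mul_of_nonneg_right hl2 (hw 1)
      _ = m 2 * U ^ 2 * ((4 : ℝ) ^ n) ^ 1 := by ring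
  have hlaw3 : (if (3 : ℕ) = 1 then 4 / 3 * R.Gfr 1 * U ^ 2 * ((4 : ℝ) ^ n) ^ 0 else if (3 : ℕ) = 2 then R.Gfr 2 * U ^ 2 * ((4 : ℝ) ^ n) ^ 1 else if (3 : ℕ) = 3 then R.Gfr 3 / 3 * U ^ 2 * ((4 : ℝ) ^ n) ^ 2 else if (3 : ℕ) = 4 then R.Gfr 4 / 15 * U ^ 2 * ((4 : ℝ) ^ n) ^ 3 else 2 ^ 5 * (Real.pi ^ 8 / 4 * 2 ^ 4 * (2 : ℝ) ^ 32) * (curveExtC X G.S 1 + curveExtC X Q.S' 1 * |U|) / 63 * U ^ 2 * ((4 : ℝ) ^ n) ^ 4) + 2 * klZspLaw z U (n + 1) 3 ≤ m 3 * U ^ 2 * ((4 : ℝ) ^ n) ^ 2 := by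
    rw [if_neg (by norm_num), if_neg (by norm_num), if_pos rfl, two_mul_klZspLaw, show (3 : ℕ) - 1 = 2 from rfl, pow_succ (4 : ℝ) n]
    calc _ = (R.Gfr 3 / 3 + 32 * z 3) * (U ^ 2 * ((4 : ℝ) ^ n) ^ 2) := by ring
      _ ≤ m 3 * (U ^ 2 * ((4 : ℝ) ^ n) ^ 2) := mul_le_mul_of_nonneg_right hl3 (hw 2)
      _ = m 3 * U ^ 2 * ((4 : ℝ) ^ n) ^ 2 := by ring
  have hlaw4 : (if (4 : ℕ) = 1 then 4 / 3 * R.Gfr 1 * U ^ 2 * ((4 : ℝ) ^ n) ^ 0 else if (4 : ℕ) = 2 then R.Gfr 2 * U ^ 2 * ((4 : ℝ) ^ n) ^ 1 else if (4 : ℕ) = 3 then R.Gfr 3 / 3 * U ^ 2 * ((4 : ℝ) ^ n) ^ 2 else if (4 : ℕ) = 4 then R.Gfr 4 / 15 * U ^ 2 * ((4 : ℝ) ^ n) ^ 3 else 2 ^ 5 * (Real.pi ^ 8 / 4 * 2 ^ 4 * (2 : ℝ) ^ 32) * (curveExtC X G.S 1 + curveExtC X Q.S' 1 * |U|) / 63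 * U ^ 2 * ((4 : ℝ) ^ n) ^ 4) + 2 * klZspLaw z U (n + 1) 4 ≤ m 4 * U ^ 2 * ((4 : ℝ) ^ n) ^ 3 := by
    rw [if_neg (by norm_num), if_neg (by norm_num), if_neg (by norm_num), if_pos rfl, two_mul_klZspLaw, show (4 : ℕ) - 1 = 3 from rfl, pow_succ (4 : ℝ) n]
    calc _ = (R.Gfr 4 / 15 + 128 * z 4) * (U ^ 2 * ((4 : ℝ) ^ n) ^ 3) := by ring
      _ ≤ m 4 * (U ^ 2 * ((4 : ℝ) ^ n) ^ 3) := mul_le_mul_of_nonneg_right hl4 (hw 3)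
      _ = m 4 * U ^ 2 * ((4 : ℝ) ^ n) ^ 3 := by ring
  have hlaw5 : (if (5 : ℕ) = 1 then 4 / 3 * R.Gfr 1 * U ^ 2 * ((4 : ℝ) ^ n) ^ 0 else if (5 : ℕ) = 2 then R.Gfr 2 * U ^ 2 * ((4 : ℝ) ^ n) ^ 1 else if (5 : ℕ) = 3 then R.Gfr 3 / 3 * U ^ 2 * ((4 : ℝ) ^ n) ^ 2 else if (5 : ℕ) = 4 then R.Gfr 4 / 15 * U ^ 2 * ((4 : ℝ) ^ n) ^ 3 else 2 ^ 5 * (Real.pi ^ 8 / 4 * 2 ^ 4 * (2 : ℝ) ^ 32) * (curveExtC X G.S 1 + curveExtC X Q.S' 1 * |U|) / 63 * U ^ 2 * ((4 : ℝ) ^ n) ^ 4) + 2 * klZspLaw z U (n + 1) 5 ≤ m 5 * U ^ 2 * ((4 : ℝ) ^ n) ^ 4 := by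
    rw [if_neg (by norm_num), if_neg (by norm_num), if_neg (by norm_num), if_neg (by norm_num), two_mul_klZspLaw, show (5 : ℕ) - 1 = 4 from rfl, pow_succ (4 : ℝ) n]
    calc _ = (2 ^ 5 * (Real.pi ^ 8 / 4 * 2 ^ 4 * (2 : ℝ) ^ 32) * (curveExtC X G.S 1 + curveExtC X Q.S' 1 * |U|) / 63 + 512 * z 5) * (U ^ 2 * ((4 : ℝ) ^ n) ^ 4) := by ring
      _ ≤ m 5 * (U ^ 2 * ((4 : ℝ) ^ n) ^ 4) := mul_le_mul_of_nonneg_right hl5 (hw 4)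
      _ = m 5 * U ^ 2 * ((4 : ℝ) ^ n) ^ 4 := by ring
  exact (transport_rows_fit_l2 hR hU hU1 hG34U n hM1' hM2' hM3' hM4' hM5' hm hlaw1 hlaw2 hlaw3 hlaw4 hlaw5
    (D := fun k => |iteratedDeriv k (fun θ : ℝ =>
        (fun q : Momentum => (symInterp L (klLocSelfEnergyRe L M β U μ (klFlowFrameU L M β U μ (n + 1)) (n + 1))).eval (WithLp.ofLp q) + (klFlowPiece L M β U μ n).eval (WithLp.ofLp q))
            (WithLp.toLp 2 (klFermiPoint μ (fsub (klFlowFrameU L M β U μ n) (klFlowPiece L M β U μ n)) θ)) -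
          (fun q : Momentum => (symInterp L (klLocSelfEnergyRe L M β U μ (klFlowFrameU L M β U μ (n + 1)) (n + 1))).eval (WithLp.ofLp q) + (klFlowPiece L M β U μ n).eval (WithLp.ofLp q))
            (WithLp.toLp 2 (klFermiPoint μ (klFlowFrameU L M β U μ n) θ))) θ|) r0 r1 r2 r3 r4 k hk)

end AtSucc

end General

end Summit.HubbardSuperconductivity.HubbardSuperconductivity.Theorems.EngineV8

end
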